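/-
Copyright (c) 2026 the pub-hodgecm-mathlib formalisation cell (harness21).  Prover seat hodgecm-mathlib-K2E3-p17 (g6), Track B «K2-LIT» ∕ h413
(`stmt-HodgeConjecture-24833`), line `K2_E3_EllipticInputs`, unit U12 §L, Richardson road for (LBGL-ge3) at `N = 3` (road owner K2E3-p11),
brick (F-J) = (S-B♭)_Lie, FILE H1a «THE SPLIT TORUS OF `GL₃`: WEYL GROUP, PERMUTATION MATRICES, THE VANDERMONDE `Δ` AND THE DISCRIMINANT».  2026-09-04.
-/
import Summits.HodgeConjecture.HodgeConjecture.Theorems.K2E3GL3OrbitChartStabilisers   -- ★ p857658 (this seat, G1): `injective_add_of_sep`, `glInt`∕`primePowBall` kits, E1 `charpoly_conj_units`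
import Literature.Algebra.Polynomial.DiscriminantRootProduct                           -- ★ `discr_prod_X_sub_C_eq_prod_prod_Ioi_sq` (`D = ∏_{i<j} (ξ_j − ξ_i)²`)
import HarnessLib

/-!
# K2_E3 road (h413), §L ∕ Richardson road at `N = 3`, brick (F-J) FILE H1a: the Weyl-group bookkeeping of the split torus of `GL₃` — which diagonal matrices are
# conjugate, permutation matrices in `K`, the Vandermonde `Δ(v) = (v₀−v₁)(v₀−v₂)(v₁−v₂)` versus `disc χ`, and `‖Δ‖` on a small box around a regular point

Cell `pub/hodgecm-mathlib` (D-0151), Track B, seat K2E3-p17 (g6), deal (D60) = (F-J) (road owner K2E3-p11).  `--supports stmt-HodgeConjecture-24833 --as helper`;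
THEOREMS ONLY (no definition ∕ instance ∕ notation ∕ named fact ∕ `sorry`); never imports `Cruxes/…/Lines`.  COUNT-NEUTRAL.  Pure algebra serving FILE H1b (the
local density of the split orbital measure) and FILE H2 (socket (LBGL-3J) `K2E3GL3BorelSliceDensity`).

CONTENTS.  §1 `exists_perm_of_conj_diagonal_eq`: `diag d = u·diag e·u⁻¹` with `d` injective ⇒ `d = e ∘ σ` for a permutation `σ` (eigenvalues, no multisets).
§2 `exists_permGL`: for `σ ∈ S₃` a `GL₃`-element `ẇ_σ` with `0∕1` entries, `ẇ_σ · diag v · ẇ_σ⁻¹ = diag (v ∘ σ)`, `ẇ_σ a ẇ_σ⁻¹ = a ∘ (σ × σ)`; over a local field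
`ẇ_σ ∈ K = GL₃(𝒪)` and `Ad(ẇ_σ)` preserves the diagonal matrices.  §3 `Δ`: `disc χ_{diag v} = Δ(v)²` (★ root-product formula), `Δ(v∘σ)² = Δ(v)²`,
`‖Δ(v ∘ σ)‖ = ‖Δ(v)‖`, `‖Δ(d₀ + z)‖ = ‖Δ(d₀)‖` for `z` in a separating box (ultrametric), `∏_{i,j} (i = j ? 1 : v_j − v_i) = −Δ(v)²` (the Jacobian of ★ E2).
§4 `g · diag e · g⁻¹` with `e` injective: `χ = ∏ (X − e_i)`, `3` rational roots, `disc χ ≠ 0`, `√‖disc χ‖ = ‖Δ(e)‖`.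
[HarishChandra1970, Part I §5 (split tori, `W = S_n`)] [HarishChandra1999AdmissibleDistributions, Lemma 7.8] [BombieriGubler2006, App. B Rem. B.1.5]
HONEST LABEL: HC_CM is proved only modulo the 7 printed citations (2 remaining named inputs: hLiu418 = stmt-HodgeConjecture-24832, h413 = stmt-HodgeConjecture-24833)
until rung 0 closes; count-neutral helper.

## References
* [HarishChandra1970] Harish-Chandra (van Dijk), *Harmonic Analysis on Reductive p-adic Groups*, LNM 162 (1970), Part I §5.
* [HarishChandra1999AdmissibleDistributions] Harish-Chandra (DeBacker–Sally), *Admissible Invariant Distributions on Reductive p-adic Groups* (1999), Lemma 7.8.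
* [BombieriGubler2006] E. Bombieri, W. Gubler, *Heights in Diophantine Geometry* (2006), Appendix B, Remark B.1.5.
-/

set_option autoImplicit false
set_option linter.dupNamespace false

noncomputable section

open Filter Topology Set Matrix ValuativeRel Polynomial
open scoped MatrixGroups NNReal ENNReal Valued
open Literature.NumberTheory.Automorphic Literature.NumberTheory.Automorphic.LocalFieldHaar
open Literature.NumberTheory.GaloisRepresentations Literature.NumberTheory.GaloisRepresentations.IsNonarchimedeanLocalField
open Summit.HodgeConjecture.HodgeConjecture.Cruxes.H413.K2E3GL3OrbitChartDeriv
open Summit.HodgeConjecture.HodgeConjecture.Cruxes.H413.K2E3GL3OrbitChartStabilisers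

namespace Summit.HodgeConjecture.HodgeConjecture.Cruxes.H413.K2E3GL3SplitTorusWeylKit

/-! ## §1  Conjugate diagonal matrices differ by a permutation -/

section Algebra

variable {K : Type*} [Field K]

/-- **`diag d = u · diag e · u⁻¹` with `d` injective ⇒ `d = e ∘ σ`, `σ ∈ S₃`** (each `d_i` is a root of `χ_{diag e} = ∏ (X − e_j)`; injectivity makes the choice
`i ↦ j` a bijection). [cite: HarishChandra1970, Part I §5] -/
theorem exists_perm_of_conj_diagonal_eq {d e : Fin 3 → K} (hd : Function.Injective d) (u : GL (Fin 3) K)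
    (h : Matrix.diagonal d = (u : Matrix (Fin 3) (Fin 3) K) * Matrix.diagonal e * ((u⁻¹ : GL (Fin 3) K) : Matrix (Fin 3) (Fin 3) K)) :
    ∃ σ : Equiv.Perm (Fin 3), d = e ∘ σ := by
  classical
  have hchar : (Matrix.diagonal d).charpoly = (Matrix.diagonal e).charpoly := by rw [h, charpoly_conj_units]
  rw [Matrix.charpoly_diagonal, Matrix.charpoly_diagonal] at hchar
  have hroot : ∀ i, ∃ j, d i = e j := by
    intro i
    have h1 : (∏ j : Fin 3, (X - C (d j))).eval (d i) = 0 := by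
      rw [eval_prod]; exact Finset.prod_eq_zero (Finset.mem_univ i) (by simp)
    rw [hchar, eval_prod] at h1
    obtain ⟨j, -, hj⟩ := Finset.prod_eq_zero_iff.1 h1
    exact ⟨j, sub_eq_zero.1 (by simpa using hj)⟩
  choose τ hτ using hroot
  have hdτ : d = e ∘ τ := funext hτ
  have hτinj : Function.Injective τ := Function.Injective.of_comp (f := e) (hdτ ▸ hd)
  exact ⟨Equiv.ofBijective τ (Finite.injective_iff_bijective.1 hτinj), hdτ⟩

/-! ## §2  Permutation matrices -/

/-- **Permutation matrices as `GL₃`-elements**: `ẇ_σ` with `(ẇ_σ)_{ij} = [σ i = j]`, `(ẇ_σ⁻¹)_{ij} = [σ⁻¹ i = j]`, `ẇ_σ a ẇ_σ⁻¹ = (a_{σ i, σ j})_{ij}`, hence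
`ẇ_σ · diag v · ẇ_σ⁻¹ = diag (v ∘ σ)`. [cite: HarishChandra1970, Part I §5] -/
theorem exists_permGL (σ : Equiv.Perm (Fin 3)) :
    ∃ m : GL (Fin 3) K,
      (∀ i j, (m : Matrix (Fin 3) (Fin 3) K) i j = if σ i = j then 1 else 0) ∧
      (∀ i j, ((m⁻¹ : GL (Fin 3) K) : Matrix (Fin 3) (Fin 3) K) i j = if σ.symm i = j then 1 else 0) ∧
      (∀ a : Matrix (Fin 3) (Fin 3) K, (m : Matrix (Fin 3) (Fin 3) K) * a * ((m⁻¹ : GL (Fin 3) K) : Matrix (Fin 3) (Fin 3) K) = a.submatrix σ σ) ∧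
      (∀ v : Fin 3 → K, (m : Matrix (Fin 3) (Fin 3) K) * Matrix.diagonal v * ((m⁻¹ : GL (Fin 3) K) : Matrix (Fin 3) (Fin 3) K) = Matrix.diagonal (v ∘ σ)) := by
  classical
  have hmul : (σ.toPEquiv.toMatrix : Matrix (Fin 3) (Fin 3) K) * σ.symm.toPEquiv.toMatrix = 1 := by
    rw [← PEquiv.toMatrix_trans, ← Equiv.toPEquiv_trans, Equiv.self_trans_symm, Equiv.toPEquiv_refl, PEquiv.toMatrix_refl]
  have hmul' : (σ.symm.toPEquiv.toMatrix : Matrix (Fin 3) (Fin 3) K) * σ.toPEquiv.toMatrix = 1 := by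
    rw [← PEquiv.toMatrix_trans, ← Equiv.toPEquiv_trans, Equiv.symm_trans_self, Equiv.toPEquiv_refl, PEquiv.toMatrix_refl]
  set m : GL (Fin 3) K := ⟨σ.toPEquiv.toMatrix, σ.symm.toPEquiv.toMatrix, hmul, hmul'⟩ with hm
  have hconj : ∀ a : Matrix (Fin 3) (Fin 3) K, (m : Matrix (Fin 3) (Fin 3) K) * a * ((m⁻¹ : GL (Fin 3) K) : Matrix (Fin 3) (Fin 3) K) = a.submatrix σ σ := by
    intro a
    show (σ.toPEquiv.toMatrix : Matrix (Fin 3) (Fin 3) K) * a * σ.symm.toPEquiv.toMatrix = a.submatrix σ σ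
    rw [PEquiv.toMatrix_toPEquiv_mul, PEquiv.mul_toMatrix_toPEquiv, Matrix.submatrix_submatrix, Equiv.symm_symm]
    rfl
  refine ⟨m, fun i j => ?_, fun i j => ?_, hconj, fun v => by rw [hconj, Matrix.submatrix_diagonal_equiv]⟩
  · show (σ.toPEquiv.toMatrix : Matrix (Fin 3) (Fin 3) K) i j = _
    rw [PEquiv.toMatrix_apply, Equiv.toPEquiv_apply]
    simp only [Option.mem_def, Option.some.injEq]
  · show (σ.symm.toPEquiv.toMatrix : Matrix (Fin 3) (Fin 3) K) i j = _
    rw [PEquiv.toMatrix_apply, Equiv.toPEquiv_apply]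
    simp only [Option.mem_def, Option.some.injEq]

/-! ## §3  The Vandermonde `Δ(v) = (v₀ − v₁)(v₀ − v₂)(v₁ − v₂)` -/

/-- **`disc χ_{diag v} = Δ(v)²`** (★ `D_{∏(X−ξ_i)} = ∏_{i<j} (ξ_j − ξ_i)²`). [cite: BombieriGubler2006, Appendix B, Remark B.1.5] -/
theorem discr_charpoly_diagonal (v : Fin 3 → K) :
    (Matrix.diagonal v).charpoly.discr = ((v 0 - v 1) * (v 0 - v 2) * (v 1 - v 2)) ^ 2 := by
  rw [Matrix.charpoly_diagonal, Literature.Algebra.Polynomial.DiscriminantRootProduct.discr_prod_X_sub_C_eq_prod_prod_Ioi_sq]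
  have h0 : Finset.Ioi (0 : Fin 3) = {1, 2} := by decide
  have h1 : Finset.Ioi (1 : Fin 3) = {2} := by decide
  have h2 : Finset.Ioi (2 : Fin 3) = ∅ := by decide
  rw [Fin.prod_univ_three, h0, h1, h2, Finset.prod_insert (by decide), Finset.prod_singleton, Finset.prod_singleton, Finset.prod_empty]
  ring

/-- `χ_{diag (v ∘ σ)} = χ_{diag v}`. [cite: HarishChandra1970, Part I §5] -/
theorem charpoly_diagonal_perm (v : Fin 3 → K) (σ : Equiv.Perm (Fin 3)) :
    (Matrix.diagonal (v ∘ σ)).charpoly = (Matrix.diagonal v).charpoly := by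
  rw [Matrix.charpoly_diagonal, Matrix.charpoly_diagonal]
  exact Equiv.prod_comp σ (fun i => X - C (v i))

/-- **`Δ(v ∘ σ)² = Δ(v)²`** (both are `disc χ_{diag v}`). [cite: HarishChandra1970, Part I §5] -/
theorem delta_perm_sq (v : Fin 3 → K) (σ : Equiv.Perm (Fin 3)) :
    (((v ∘ σ) 0 - (v ∘ σ) 1) * ((v ∘ σ) 0 - (v ∘ σ) 2) * ((v ∘ σ) 1 - (v ∘ σ) 2)) ^ 2 = ((v 0 - v 1) * (v 0 - v 2) * (v 1 - v 2)) ^ 2 := by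
  rw [← discr_charpoly_diagonal, ← discr_charpoly_diagonal, charpoly_diagonal_perm]

/-- **`∏_{i,j} (i = j ? 1 : v_j − v_i) = −Δ(v)²`** — the entrywise Jacobian of the orbit chart of ★ E2 at `diag v`. [cite: HarishChandra1999AdmissibleDistributions, Lemma 7.8] -/
theorem prod_prod_ite_eq (v : Fin 3 → K) :
    (∏ i : Fin 3, ∏ j : Fin 3, (if i = j then (1 : K) else v j - v i)) = -(((v 0 - v 1) * (v 0 - v 2) * (v 1 - v 2)) ^ 2) := by
  simp only [Fin.prod_univ_three, Fin.isValue]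
  simp
  ring

/-- **`χ_{g · diag e · g⁻¹} = ∏ (X − e_i)`**. [cite: HarishChandra1970, Part I §5] -/
theorem charpoly_conj_diagonal (g : GL (Fin 3) K) (e : Fin 3 → K) :
    ((g : Matrix (Fin 3) (Fin 3) K) * Matrix.diagonal e * ((g⁻¹ : GL (Fin 3) K) : Matrix (Fin 3) (Fin 3) K)).charpoly = ∏ i : Fin 3, (X - C (e i)) := by
  rw [charpoly_conj_units, Matrix.charpoly_diagonal]

/-- **`disc χ_{g · diag e · g⁻¹} = Δ(e)²`**. [cite: BombieriGubler2006, Appendix B, Remark B.1.5] -/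
theorem discr_charpoly_conj_diagonal (g : GL (Fin 3) K) (e : Fin 3 → K) :
    ((g : Matrix (Fin 3) (Fin 3) K) * Matrix.diagonal e * ((g⁻¹ : GL (Fin 3) K) : Matrix (Fin 3) (Fin 3) K)).charpoly.discr =
      ((e 0 - e 1) * (e 0 - e 2) * (e 1 - e 2)) ^ 2 := by
  rw [charpoly_conj_units, discr_charpoly_diagonal]

/-- `Δ(e) ≠ 0` for injective `e`. [folklore] -/
theorem delta_ne_zero {e : Fin 3 → K} (he : Function.Injective e) : (e 0 - e 1) * (e 0 - e 2) * (e 1 - e 2) ≠ 0 := by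
  refine mul_ne_zero (mul_ne_zero ?_ ?_) ?_ <;> rw [sub_ne_zero] <;> intro h <;> exact absurd (he h) (by decide)

/-- **`g · diag e · g⁻¹` (`e` injective) has `3` rational characteristic roots** (`roots χ = {e₀, e₁, e₂}`). [cite: HarishChandra1970, Part I §5] -/
theorem card_roots_charpoly_conj_diagonal (g : GL (Fin 3) K) (e : Fin 3 → K) :
    ((g : Matrix (Fin 3) (Fin 3) K) * Matrix.diagonal e * ((g⁻¹ : GL (Fin 3) K) : Matrix (Fin 3) (Fin 3) K)).charpoly.roots.card = 3 := by
  classical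
  rw [charpoly_conj_diagonal]
  have h1 : (∏ i : Fin 3, (X - C (e i))) = ((Finset.univ.val.map e).map fun a => X - C a).prod := by
    rw [Finset.prod_eq_multiset_prod, Multiset.map_map]; rfl
  rw [h1, roots_multiset_prod_X_sub_C, Multiset.card_map, Finset.card_val, Finset.card_univ, Fintype.card_fin]

/-- **`disc χ ≠ 0` on the conjugates of a regular diagonal matrix.** [cite: HarishChandra1970, Part I §5] -/
theorem discr_charpoly_conj_diagonal_ne_zero (g : GL (Fin 3) K) {e : Fin 3 → K} (he : Function.Injective e) :
    ((g : Matrix (Fin 3) (Fin 3) K) * Matrix.diagonal e * ((g⁻¹ : GL (Fin 3) K) : Matrix (Fin 3) (Fin 3) K)).charpoly.discr ≠ 0 := by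
  rw [discr_charpoly_conj_diagonal]; exact pow_ne_zero 2 (delta_ne_zero he)

end Algebra

/-! ## §3′–§4  Over a non-archimedean local field: `‖Δ‖`, the box, `K` -/

section LocalField

variable {F : Type*} [Field F] [ValuativeRel F] [TopologicalSpace F] [IsNonarchimedeanLocalField F]

/-- **`‖Δ(v ∘ σ)‖ = ‖Δ(v)‖`.** [cite: HarishChandra1970, Part I §5] -/
theorem normAbs_delta_perm (v : Fin 3 → F) (σ : Equiv.Perm (Fin 3)) :
    normAbs F (((v ∘ σ) 0 - (v ∘ σ) 1) * ((v ∘ σ) 0 - (v ∘ σ) 2) * ((v ∘ σ) 1 - (v ∘ σ) 2)) = normAbs F ((v 0 - v 1) * (v 0 - v 2) * (v 1 - v 2)) := by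
  have h := congrArg (normAbs F) (delta_perm_sq v σ)
  rw [map_pow, map_pow] at h
  exact (pow_left_inj₀ zero_le zero_le two_ne_zero).1 h

/-- **`‖Δ(d₀ + z)‖ = ‖Δ(d₀)‖` for `z ∈ (𝔭^k)³` at a level `k` separating `d₀`** (`‖(d_i − d_j) + (z_i − z_j)‖ = ‖d_i − d_j‖`, ultrametric).
[cite: HarishChandra1999AdmissibleDistributions, Lemma 7.8] -/
theorem normAbs_delta_add_eq {d z : Fin 3 → F} {k : ℕ}
    (hsep : ∀ i j, i ≠ j → ((residueFieldCard F : ℝ≥0)⁻¹) ^ (k : ℤ) < normAbs F (d i - d j)) (hz : ∀ i, z i ∈ primePowBall F k) :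
    normAbs F (((d + z) 0 - (d + z) 1) * ((d + z) 0 - (d + z) 2) * ((d + z) 1 - (d + z) 2)) = normAbs F ((d 0 - d 1) * (d 0 - d 2) * (d 1 - d 2)) := by
  have key : ∀ i j, i ≠ j → normAbs F ((d + z) i - (d + z) j) = normAbs F (d i - d j) := by
    intro i j hij
    have h1 : (d + z) i - (d + z) j = (d i - d j) + (z i - z j) := by simp only [Pi.add_apply]; ring
    rw [h1]
    refine normAbs_add_eq_of_lt (lt_of_le_of_lt ?_ (hsep i j hij))
    rw [sub_eq_add_neg]
    exact (mem_primePowBall_iff.1 (add_mem_primePowBall (hz i) (neg_mem_primePowBall (hz j))))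
  simp only [map_mul]
  rw [key 0 1 (by decide), key 0 2 (by decide), key 1 2 (by decide)]

/-- **`√‖disc χ_{g·diag e·g⁻¹}‖ = ‖Δ(e)‖`.** [cite: HarishChandra1999AdmissibleDistributions, Lemma 7.8] -/
theorem sqrt_normAbs_discr_charpoly_conj_diagonal (g : GL (Fin 3) F) (e : Fin 3 → F) :
    NNReal.sqrt (normAbs F ((g : Matrix (Fin 3) (Fin 3) F) * Matrix.diagonal e * ((g⁻¹ : GL (Fin 3) F) : Matrix (Fin 3) (Fin 3) F)).charpoly.discr) =
      normAbs F ((e 0 - e 1) * (e 0 - e 2) * (e 1 - e 2)) := by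
  rw [discr_charpoly_conj_diagonal, map_pow, NNReal.sqrt_sq]

/-- **The Jacobian of ★ E2 in `Δ`-form**: `‖∏_{i,j} (i = j ? 1 : d_j − d_i)‖ = ‖Δ(d)‖²`. [cite: HarishChandra1999AdmissibleDistributions, Lemma 7.8] -/
theorem normAbs_prod_prod_ite_eq (d : Fin 3 → F) :
    normAbs F (∏ i : Fin 3, ∏ j : Fin 3, (if i = j then (1 : F) else d j - d i)) = normAbs F ((d 0 - d 1) * (d 0 - d 2) * (d 1 - d 2)) ^ 2 := by
  rw [prod_prod_ite_eq, normAbs_neg, map_pow]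

omit [TopologicalSpace F] [IsNonarchimedeanLocalField F] in
/-- **Permutation matrices lie in `K = GL₃(𝒪)` and `Ad(ẇ_σ)` preserves the diagonal matrices.** [cite: HarishChandra1970, Part I §5] -/
theorem exists_permGL_mem_glInt (σ : Equiv.Perm (Fin 3)) :
    ∃ m : GL (Fin 3) F, m ∈ glInt 3 F ∧
      (∀ a : GL (Fin 3) F, (∀ i j, i ≠ j → (a : Matrix (Fin 3) (Fin 3) F) i j = 0) →
        ∀ i j, i ≠ j → ((m * a * m⁻¹ : GL (Fin 3) F) : Matrix (Fin 3) (Fin 3) F) i j = 0) ∧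
      (∀ v : Fin 3 → F, (m : Matrix (Fin 3) (Fin 3) F) * Matrix.diagonal v * ((m⁻¹ : GL (Fin 3) F) : Matrix (Fin 3) (Fin 3) F) = Matrix.diagonal (v ∘ σ)) := by
  obtain ⟨m, hm, hminv, hconj, hdiag⟩ := exists_permGL (K := F) σ
  refine ⟨m, ?_, fun a ha i j hij => ?_, hdiag⟩
  · rw [mem_glInt_iff]
    refine ⟨fun i j => ?_, fun i j => ?_⟩
    · rw [hm]; split_ifs
      · exact one_mem _
      · exact zero_mem _
    · rw [hminv]; split_ifs
      · exact one_mem _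
      · exact zero_mem _
  · rw [Units.val_mul, Units.val_mul, hconj, Matrix.submatrix_apply]
    exact ha _ _ (fun h => hij (σ.injective h))

end LocalField

end Summit.HodgeConjecture.HodgeConjecture.Cruxes.H413.K2E3GL3SplitTorusWeylKit

end
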